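import Summits.QuantumFields.BalabanUV.T4Continuum.Support.ShellMeasureLiveEndOneCallSlotLevelsCfLinCoTests
import Summits.QuantumFields.BalabanUV.T4Continuum.Support.ShellMeasureLiveEndOneCallGibbs
import Summits.QuantumFields.BalabanUV.T4Continuum.Support.ShellMeasureRootCompositionSync

/-!
# `T4Continuum.ShellMeasureLiveEndOneCallUnionLevelsCfLinCoTests` — row S107 file 3⁵ «THE ONE CALL v4 — R05 RE-SOURCED»: BOTH KINDS OF LIVE SLOTS —
# the Gibbs slots `S₀ r K` (leaf-06-g7's f1b, unchanged) ⊔ the background-mediated slots `S₁ r K` (S104 f4 via file 1⁵)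
(cell `pub-balaban`, sub-cell `t4`, NE7c (node U5b); crew unit `b2b-balaban-t4-ne7c-formalise-leaf-09` gen 13; owner table row **S107**
(R-ne7cp1-g36-9); imports file 1⁵ `ShellMeasureLiveEndOneCallSlotLevelsCfLinCoTests`, f1b `ShellMeasureLiveEndOneCallGibbs` (leaf-06-g7, p231442) and S27
`ShellMeasureRootCompositionSync` ONLY; [folklore]; 0 `def`, 0 `def … : Prop`, 0 sorry, 0 cite; END-II block generated by files 1″∕2″'s script
in «inr» mode; files 1⁗∕2⁗'s script)

HONEST FRAMING.  Finite four-torus programme, rung (B)+1 only — NOT infinite volume, NOT a mass gap, NOT the Clay problem, NOT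
summit progress; (B), `BetaPertHyp`, (B^μ) not consumed.  NE7c (`T4IndicatorShell.ShellWeightBound`) is NOT PRINTED in
[Balaban 1983–89] and NOT PROVED; «NE7c ⇐ the named binders» (trigger c3): every binder below is DISPLAYED, asserted by nobody;
no estimate of Bałaban's is discharged; (M1)₀ ∕ (M1) realized ≠ NE7c.  THIS declaration IS the countdown's object at the live
levels (level-0 slots served by the level-0 face); landing it moves NOTHING by itself.  HONEST DEPENDENCY (cell): continuum YM
on T⁴ ⇐ BetaPertH ∧ nine spine estimates (0/9 proved); BetaPertH ⇐ (D1) ∧ (D4) ∧ CAP+tail; G-an2-4 gates asym, D1 and NE2/3/4.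

WHAT IS PROVED ([folklore]).  **`shellWeightBound_live_oneCall_union_levels_cfB7_lin_coTests`** — S102 f3″ `…UnionLevelsCf.shellWeightBound_live_oneCall_union_levels_cfB7_lin_coTests_levels_cfB7`
RE-TYPED over file 1⁵ (S104 f4's END, leaf-10-g13; R05's window∕co-test data `W Jco hJW hJ hJ1 hWS` GONE — S94's kernel; the
per-neighbour families + `hANN` [T] displayed instead; R10∕R11 as in S105): slot type `σ₀ ⊕ σ₁`, END-I's slot sets
`(S₀ r K).disjSum (S₁ r K)`; on `Sum.inr s` EVERY S104 f4 binder as an `(r, K, t, s)`-family (file 1⁵'s list, `κr κc κwb κcb dbar Kw`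
level-lifted) + `hDslot` guarded on `S₁`; on `Sum.inl s` leaf-06-g7's GIBBS
family UNCHANGED (box binders renamed `lo₀ hi₀ hN₀ hΛbox₀ hΛcomb₀ hrad₀`); END-I's rows VERBATIM.  PROOF: `Finset.mem_disjSum` cases — inl by
f1b `hac_gibbs_of_identified`, inr by file 1⁵ + `slotAntiConcentration_mono` — into S27 `shellWeightBound_of_towerData_sync`.  CONCLUSION
LITERALLY `ShellWeightBound l₀ T A B shA shB (fun K => Σ over the two disjoint sums)`; (t1)–(t4) as file 2⁵; (x3⁵) = the owner's census
re-run; THE ONE CALL OF RECORD v4 only on the owner's ruling + outside XREAD.  Nothing of Bałaban's discharged.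
-/

noncomputable section

open Set Metric NormedSpace MeasureTheory Function Finset
open scoped ENNReal

namespace Summit.QuantumFields.BalabanUV.T4Continuum.ShellMeasureLiveEndOneCallUnionLevelsCfLinCoTests

open Literature.MathematicalPhysics.QuantumFieldTheory.Balaban1983to89
open B11Prop6Scheme (Prop4Hyp)
open GaugeField (GaugeInvariant)
open T4IndicatorShell (ShellWeightBound)
open T4ShellMeasure (SlotAntiConcentration)
open T4ShellMeasureLevels (LiveWindow)
open T4ShellMeasureFibre (slotAntiConcentration_mono)
open T4CubePoincare (cube)
open T4CubeChartGnomonic (SU2)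
open T4CubeChartExp (expFibreChart)
open T4TreeGaugeFixing (NoClosedLoop fixTo)
open T4AxialGaugeFixing (combBonds)
open T4AxialGaugeSmallField (boxPlaqs boxBonds)
open T4ShellMeasurePlaquette (expTail₂)
open ShellMeasureLevelAssembly (classifier)
open ShellMeasureMultiGridNorms (WSup)
open ShellMeasurePinnedNorm (pinW)
open ShellMeasureDecayKernelSums (kerOp)
open ShellMeasureLandauHolonomy (solAt landauExp)
open ShellMeasureLandauHolonomyChart (holOf cplx)
open ShellMeasureLandauHolonomySkew (readOutReal)
open ShellMeasureMultiGridNorms.WSup (toPiL)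
open B7Prop2Explicit (C0 c2' unitaryUnits)
open B7Prop1Local (pdevOn loK bondHiK)
open B7Prop5Flat (BondIn)
open ShellMeasureAverageProp4General (O1cov C2cov)
open ShellMeasureLandauCorrectionB7 (landauCf landauRad)
open ShellMeasureLandauCorrectionReal (skewPi)
open ShellMeasureLandauCfBoxLocal (landauCfBox)
open ShellMeasureWilsonRealizedSU2 (wilsonU)
open ShellMeasureWilsonGaugeInvariant (giF)
open ShellMeasureRootCompositionSync (shellWeightBound_of_towerData_sync)
open ShellMeasureLiveEndOneCallSlotLevelsCfLinCoTests (hac_live_of_assembled_decay_levels_cfB7_lin_coTests)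
open ShellMeasureLiveEndOneCallGibbs (hac_gibbs_of_identified)
open scoped Matrix.Norms.L2Operator

variable {σ₀ σ₁ : Type*} {n : Type*} [Fintype n] [DecidableEq n] [Nonempty n]

/-- **`ShellWeightBound` ⇐ THE NAMED BINDERS AT THE LIVE LEVELS, GIBBS SLOTS ⊔ BACKGROUND-MEDIATED SLOTS** (row S107 file 3⁵; module docstring);
CONDITIONAL on every displayed binder; nothing PRINTED is asserted; NOT Bałaban's minimiser; NE7c NOT proved; R05 re-sourced (S104 f4), R10∕R11 discharged. [folklore] -/
theorem shellWeightBound_live_oneCall_union_levels_cfB7_lin_coTests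
    (P : Bool → ℕ → σ₀ ⊕ σ₁ → Params) (jl lvl : Bool → ℕ → σ₀ ⊕ σ₁ → ℕ) [∀ r K s, DecidableEq (PBond (P r K s) (jl r K s))]
    {ε η ρ β D : Bool → ℕ → ℝ} (hη : ∀ r j, 0 < η r j) (hε : ∀ r a, 0 < ε r a) (hρ0 : ∀ r j, 0 ≤ ρ r j) (hD0 : ∀ r j, 0 ≤ D r j)
    (S₀ : Bool → ℕ → Finset σ₀) (S₁ : Bool → ℕ → Finset σ₁) {l₀ : ℝ}
    (F : ∀ r K (t : ℝ) (s : σ₀ ⊕ σ₁), GaugeField (P r K s) (jl r K s) SU2 → ℝ≥0∞)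
    (u : ∀ r K (t : ℝ) (s : σ₀ ⊕ σ₁), GaugeField (P r K s) (jl r K s) SU2 → ℝ)
    -- ══ ON `Sum.inr s` (s : σ₁): EVERY END-II binder of S104 f4 as an (r, K, t, s)-family — file 1⁵'s list in «inr» form ══
    {𝒴 𝒵 ℬ : Bool → ℕ → σ₁ → Type*} [∀ r K s, NormedAddCommGroup (𝒴 r K s)] [∀ r K s, NormedSpace ℂ (𝒴 r K s)] [∀ r K s, CompleteSpace (𝒴 r K s)]
    [∀ r K s, NormedAddCommGroup (𝒵 r K s)] [∀ r K s, NormedSpace ℂ (𝒵 r K s)] [∀ r K s, NormedAddCommGroup (ℬ r K s)]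
    [∀ r K s, NormedSpace ℂ (ℬ r K s)] {𝔸 : Bool → ℕ → σ₁ → Type*} [∀ r K s, CStarAlgebra (𝔸 r K s)] [∀ r K s, Nontrivial (𝔸 r K s)]
    {lo hi : ∀ r K s, Fin (P r K (Sum.inr s)).d → ℤ} {nb : Bool → ℕ → σ₁ → ℕ} (hn : ∀ r K s, ∀ κ, hi r K s κ ≤ lo r K s κ + nb r K s)
    (hN : ∀ r K s, ∀ κ, hi r K s κ - lo r K s κ < (P r K (Sum.inr s)).sitesPerDir (jl r K (Sum.inr s)))
    (Λ : ∀ r K s, Finset (PBond (P r K (Sum.inr s)) (jl r K (Sum.inr s)))) (hΛbox : ∀ r K s, ∀ b ∈ Λ r K s, b ∈ boxBonds (lo r K s) (hi r K s))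
    (hΛcomb : ∀ r K s, Disjoint (Λ r K s) (combBonds (lo r K s) (hi r K s))) {m₀ : Bool → ℕ → σ₁ → ℕ}
    (e : ∀ r K s, ↥(Λ r K s) × Fin 3 ≃ Fin (m₀ r K s)) {S : ℝ} (hS : 0 < S) (hSπ : 3 * S ^ 2 < Real.pi ^ 2)
    (hF : ∀ r K t s, Measurable (F r K t (Sum.inr s))) (hFi : ∀ r K t s, GaugeInvariant (F r K t (Sum.inr s)))
    (hu : ∀ r K t s, Measurable (u r K t (Sum.inr s))) (hui : ∀ r K t s, GaugeInvariant (u r K t (Sum.inr s))) {ιc : Bool → ℕ → σ₁ → Type*}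
    {Pu : ∀ r K (t : ℝ) s, Finset (ιc r K s)} (hPu : ∀ r K t s, (Pu r K t s).Nonempty) {κN : Bool → ℕ → σ₁ → Type*}
    (N : ∀ r K (t : ℝ) s, Finset (κN r K s)) {ιN : ∀ r K s, κN r K s → Type*} {PuN : ∀ r K (t : ℝ) s, (i : κN r K s) → Finset (ιN r K s i)}
    (hPuN : ∀ r K t s, ∀ i, (PuN r K t s i).Nonempty) {AN : Bool → ℕ → σ₁ → Type*} [∀ r K s, NormedRing (AN r K s)]
    [∀ r K s, NormedAlgebra ℂ (AN r K s)] [∀ r K s, CompleteSpace (AN r K s)]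
    (holN : ∀ r K (t : ℝ) s, (i : κN r K s) → GaugeField (P r K (Sum.inr s)) (jl r K (Sum.inr s)) SU2 → ιN r K s i → (Fin (m₀ r K s) → ℝ) → AN r K s)
    {θN RN HN δN : ∀ r K (t : ℝ) s, κN r K s → ℝ} (hRN : ∀ r K t s, ∀ i ∈ N r K t s, 1 < RN r K t s i)
    (hθN : ∀ r K t s, ∀ i ∈ N r K t s, 0 < θN r K t s i) (hδ0N : ∀ r K t s, ∀ i ∈ N r K t s, 0 ≤ δN r K t s i)
    (hδ1N : ∀ r K t s, ∀ i ∈ N r K t s, δN r K t s i ≤ 1)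
    (hSMN : ∀ r K t s, ∀ i ∈ N r K t s, 36 * HN r K t s i * 1 ^ 2 / (RN r K t s i - 1) ^ 2 ≤ δN r K t s i * θN r K t s i)
    (hANN : ∀ r K t s, ∀ i ∈ N r K t s, ∀ V, ∀ x ∈ closedBall (0 : Fin (m₀ r K s) → ℝ) S, ∀ p ∈ PuN r K t s i, ∃ f : ℂ → AN r K s, DifferentiableOn ℂ
      f (ball 0 (RN r K t s i)) ∧ (∀ w ∈ ball (0 : ℂ) (RN r K t s i), ‖f w‖ ≤ HN r K t s i) ∧ f 0 = 0 ∧ ∀ c : ℝ, 0 ≤ c → c ≤ 1 → f (c : ℂ) = holN r K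
      t s i V p (c • x) - 1)
    {δ : ℝ} (𝒢 : ∀ r K (t : ℝ) s, GaugeField (P r K (Sum.inr s)) (jl r K (Sum.inr s)) SU2 → (𝒵 r K s →L[ℂ] (𝒴 r K s)))
    (W𝒱 : ∀ r K (t : ℝ) s, GaugeField (P r K (Sum.inr s)) (jl r K (Sum.inr s)) SU2 → 𝒴 r K s → 𝒵 r K s) {B₀ C₄ a₃ ε₄ : ℝ}
    (h𝒢 : ∀ r K t s, ∀ V f, ‖𝒢 r K t s V f‖ ≤ B₀ * ‖f‖) (hW : ∀ r K t s, ∀ V, Prop4Hyp (W𝒱 r K t s V) C₄ a₃) (hB₀ : 0 < B₀) (hC₄ : 0 ≤ C₄)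
    (hε₄ : 0 ≤ ε₄) {dL C₁ B₃ ε₁ : ℝ} (hdL : 0 ≤ dL) (hC₁ : 0 ≤ C₁) (hε₁ : 0 ≤ ε₁) (hB₃ : dL ≤ B₃) (h1 : 2 * B₀ * C₁ * B₃ * ε₁ ≤ ε₄) (h2 : 4 * ε₄ ≤ a₃)
    (h3 : 16 * B₀ * C₄ * ε₄ ≤ 1) (H₁ : ∀ r K (t : ℝ) s, GaugeField (P r K (Sum.inr s)) (jl r K (Sum.inr s)) SU2 → (ℬ r K s →L[ℂ] (𝒴 r K s)))
    (hH₁ : ∀ r K t s, ∀ V B, ‖H₁ r K t s V B‖ ≤ B₀ * ‖B‖)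
    (TΦ : ∀ r K (t : ℝ) s, GaugeField (P r K (Sum.inr s)) (jl r K (Sum.inr s)) SU2 → ((Fin (m₀ r K s) → ℂ) →L[ℂ] (ℬ r K s))) {rΦ : ℝ}
    (hTb : ∀ r K t s, ∀ V, ‖TΦ r K t s V‖ * rΦ < 2 * dL * C₁ * ε₁) (hSr : S < rΦ) (k : Bool → ℕ → σ₁ → ℕ)
    (Sf Sf' Sw Sw' Se Se' : ∀ r K s, Finset (B7Prop1Explicit.Site (P r K (Sum.inr s)).d × Fin (P r K (Sum.inr s)).d))
    (Ubg : ∀ r K (t : ℝ) s, GaugeField (P r K (Sum.inr s)) (jl r K (Sum.inr s)) SU2 → B7Prop1Explicit.Site (P r K (Sum.inr s)).d → Fin (P r K (Sum.inr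
      s)).d → (𝔸 r K s)ˣ)
    (hUbg : ∀ r K t s, ∀ V x κ, Ubg r K t s V x κ ∈ unitaryUnits (𝔸 r K s)) {α₀ : ℝ} (hα : 0 < α₀)
    (hα3 : ∀ r K s, C0 (P r K (Sum.inr s)).d * α₀ ≤ 1 / 3) (hα4 : ∀ r K s, 4 * α₀ ≤ c2' (P r K (Sum.inr s)).d (P r K (Sum.inr s)).L)
    (hα6 : ∀ r K s, 4 * O1cov (P r K (Sum.inr s)).d * α₀ ≤ 1 / 3)
    (h52locw : ∀ r K t s, ∀ V (c : ↥(Sw' r K s)), pdevOn (loK (P r K (Sum.inr s)).L (k r K s) c.1.1) (bondHiK (P r K (Sum.inr s)).L (k r K s) c.1.1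
      c.1.2) (Ubg r K t s V) < α₀ * ((((P r K (Sum.inr s)).L : ℝ) ^ k r K s)⁻¹) ^ 2)
    (h52loce : ∀ r K t s, ∀ V (c : ↥(Se' r K s)), pdevOn (loK (P r K (Sum.inr s)).L (k r K s) c.1.1) (bondHiK (P r K (Sum.inr s)).L (k r K s) c.1.1
      c.1.2) (Ubg r K t s V) < α₀ * ((((P r K (Sum.inr s)).L : ℝ) ^ k r K s)⁻¹) ^ 2)
    (ϖe₁ : ∀ r K (t : ℝ) s, ↥(Se r K s) → ℝ) (ϖe₂ : ∀ r K (t : ℝ) s, ↥(Se' r K s) → ℝ) (hϖe₁ : ∀ r K t s, ∀ b, 0 ≤ ϖe₁ r K t s b)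
    (hϖe₂ : ∀ r K t s, ∀ c, 0 ≤ ϖe₂ r K t s c) {r₀e : ℝ}
    (hreache : ∀ r K t s, ∀ (c : ↥(Se' r K s)) (b : ↥(Se r K s)), BondIn (loK (P r K (Sum.inr s)).L (k r K s) c.1.1) (bondHiK (P r K (Sum.inr s)).L (k
      r K s) c.1.1 c.1.2) b.1.1 b.1.2 → ϖe₂ r K t s c - r₀e ≤ ϖe₁ r K t s b)
    (ιs : ∀ r K (t : ℝ) s, GaugeField (P r K (Sum.inr s)) (jl r K (Sum.inr s)) SU2 → (𝒴 r K s →L[ℂ] (↥(Sf r K s) → 𝔸 r K s)))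
    (hι : ∀ r K t s, ∀ V Y, ‖ιs r K t s V Y‖ ≤ ‖Y‖)
    (Hop : ∀ r K (t : ℝ) s, GaugeField (P r K (Sum.inr s)) (jl r K (Sum.inr s)) SU2 → ((↥(Sf' r K s) → 𝔸 r K s) →L[ℂ] (𝒴 r K s)))
    (hH : ∀ r K t s, ∀ V X, ‖Hop r K t s V X‖ ≤ B₀ * ‖X‖) {ε₃ : ℝ} (h18 : ∀ r K s, 18 * C2cov (P r K (Sum.inr s)).d * B₀ * ε₃ ≤ 1)
    (hcoup : ε₄ + B₀ * (2 * dL * C₁ * ε₁) ≤ ε₃) (h3R : ∀ r K s, 3 * ε₃ ≤ landauRad (P r K (Sum.inr s)).d (P r K (Sum.inr s)).L)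
    (ℓs : ∀ r K (t : ℝ) s, ιc r K s → List (𝒴 r K s →L[ℂ] Matrix n n ℂ)) {κr : Bool → ℕ → ℝ} (hκ : ∀ r K s, 0 ≤ κr r (jl r K (Sum.inr s)))
    (hℓ : ∀ r K t s, ∀ p ∈ Pu r K t s, ∀ ℓ ∈ ℓs r K t s p, ∀ Y, ‖ℓ Y‖ ≤ κr r (jl r K (Sum.inr s)) * ‖Y‖) {m : ℕ}
    (hlen : ∀ r K t s, ∀ p ∈ Pu r K t s, (ℓs r K t s p).length ≤ m) {κc : Bool → ℕ → ℝ} (hκc : ∀ r K s, 0 ≤ κc r (jl r K (Sum.inr s)))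
    (hcurl : ∀ r K t s, ∀ p ∈ Pu r K t s, ∀ Y, ‖((ℓs r K t s p).map fun ℓ => ℓ Y).sum‖ ≤ κc r (jl r K (Sum.inr s)) * ‖Y‖)
    {Λw Λz Λb 𝔖 : Bool → ℕ → σ₁ → Type*} [∀ r K s, Fintype (Λw r K s)] [∀ r K s, DecidableEq (Λw r K s)] [∀ r K s, Fintype (Λz r K s)]
    [∀ r K s, Fintype (Λb r K s)] {𝔄w ℭ 𝔇 : Bool → ℕ → σ₁ → Type*} [∀ r K s, NormedAddCommGroup (𝔄w r K s)] [∀ r K s, NormedSpace ℂ (𝔄w r K s)]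
    [∀ r K s, CompleteSpace (𝔄w r K s)] [∀ r K s, NormedAddCommGroup (ℭ r K s)] [∀ r K s, NormedSpace ℂ (ℭ r K s)]
    [∀ r K s, NormedAddCommGroup (𝔇 r K s)] [∀ r K s, NormedSpace ℂ (𝔇 r K s)] {δw : ℝ} (hδw : 0 ≤ δw) (ϖw : ∀ r K (t : ℝ) s, 𝔖 r K s → ℝ)
    (dis : ∀ r K (t : ℝ) s, 𝔖 r K s → 𝔖 r K s → ℝ) (hϖw : ∀ r K t s, ∀ x y, ϖw r K t s x ≤ ϖw r K t s y + dis r K t s x y)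
    (pos : ∀ r K (t : ℝ) s, Λw r K s → 𝔖 r K s) (posz : ∀ r K (t : ℝ) s, Λz r K s → 𝔖 r K s) (pos' : ∀ r K (t : ℝ) s, ↥(Sw r K s) → 𝔖 r K s)
    (posx : ∀ r K (t : ℝ) s, ↥(Sw' r K s) → 𝔖 r K s) (posb : ∀ r K (t : ℝ) s, Λb r K s → 𝔖 r K s)
    (k𝒢 : ∀ r K (t : ℝ) s, GaugeField (P r K (Sum.inr s)) (jl r K (Sum.inr s)) SU2 → Λw r K s → Λz r K s → (ℭ r K s →L[ℂ] (𝔄w r K s)))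
    (kι : ∀ r K (t : ℝ) s, GaugeField (P r K (Sum.inr s)) (jl r K (Sum.inr s)) SU2 → ↥(Sw r K s) → Λw r K s → (𝔄w r K s →L[ℂ] (𝔸 r K s)))
    (kH : ∀ r K (t : ℝ) s, GaugeField (P r K (Sum.inr s)) (jl r K (Sum.inr s)) SU2 → Λw r K s → ↥(Sw' r K s) → (𝔸 r K s →L[ℂ] (𝔄w r K s)))
    (kH₁ : ∀ r K (t : ℝ) s, GaugeField (P r K (Sum.inr s)) (jl r K (Sum.inr s)) SU2 → Λw r K s → Λb r K s → (𝔇 r K s →L[ℂ] (𝔄w r K s)))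
    {c𝒢 δ𝒢 M𝒢 cι δι Mι cH δH MH cH₁ δH₁ MH₁ : ℝ} (hc𝒢 : 0 ≤ c𝒢) (hM𝒢 : 0 ≤ M𝒢)
    (hk𝒢 : ∀ r K t s, ∀ V c b', ‖k𝒢 r K t s V c b'‖ ≤ c𝒢 * Real.exp (-(δ𝒢 * dis r K t s (pos r K t s c) (posz r K t s b'))))
    (hM𝒢' : ∀ r K t s, ∀ x, ∑ b', Real.exp (-((δ𝒢 - δw) * dis r K t s x (posz r K t s b'))) ≤ M𝒢) (hcι : 0 ≤ cι) (hMι : 0 ≤ Mι)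
    (hkι : ∀ r K t s, ∀ V c b', ‖kι r K t s V c b'‖ ≤ cι * Real.exp (-(δι * dis r K t s (pos' r K t s c) (pos r K t s b'))))
    (hMι' : ∀ r K t s, ∀ x, ∑ b', Real.exp (-((δι - δw) * dis r K t s x (pos r K t s b'))) ≤ Mι) (hcH : 0 ≤ cH) (hMH : 0 ≤ MH)
    (hkH : ∀ r K t s, ∀ V c b', ‖kH r K t s V c b'‖ ≤ cH * Real.exp (-(δH * dis r K t s (pos r K t s c) (posx r K t s b'))))
    (hMH' : ∀ r K t s, ∀ x, ∑ b', Real.exp (-((δH - δw) * dis r K t s x (posx r K t s b'))) ≤ MH) (hcH₁ : 0 ≤ cH₁) (hMH₁ : 0 ≤ MH₁)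
    (hkH₁ : ∀ r K t s, ∀ V c b', ‖kH₁ r K t s V c b'‖ ≤ cH₁ * Real.exp (-(δH₁ * dis r K t s (pos r K t s c) (posb r K t s b'))))
    (hMH₁' : ∀ r K t s, ∀ x, ∑ b', Real.exp (-((δH₁ - δw) * dis r K t s x (posb r K t s b'))) ≤ MH₁)
    (W𝒱w : ∀ r K (t : ℝ) s, GaugeField (P r K (Sum.inr s)) (jl r K (Sum.inr s)) SU2 → (Λw r K s → 𝔄w r K s) → (Λz r K s → ℭ r K s))
    {B₀w C₄w a₃w ε₄w bw : ℝ} (h𝒢w : ∀ r K t s, ∀ V f, ‖kerOp (k𝒢 r K t s V) f‖ ≤ B₀w * ‖f‖) (hWw : ∀ r K t s, ∀ V, Prop4Hyp (W𝒱w r K t s V) C₄w a₃w)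
    (hB₀w : 0 < B₀w) (hC₄w : 0 ≤ C₄w) (hε₄w : 0 ≤ ε₄w) (hdomw : 2 * (ε₄w + B₀w * bw) ≤ a₃w) (hselfw : B₀w * C₄w * (ε₄w + B₀w * bw) ^ 2 ≤ ε₄w)
    (hcontrw : 4 * B₀w * C₄w * (ε₄w + B₀w * bw) < 1) (hH₁w : ∀ r K t s, ∀ V B, ‖kerOp (kH₁ r K t s V) B‖ ≤ B₀w * ‖B‖)
    (Tw : ∀ r K (t : ℝ) s, GaugeField (P r K (Sum.inr s)) (jl r K (Sum.inr s)) SU2 → ((Fin (m₀ r K s) → ℂ) →L[ℂ] (Λb r K s → 𝔇 r K s))) {rΦw : ℝ}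
    (hTbw : ∀ r K t s, ∀ V, ‖Tw r K t s V‖ * rΦw < bw) (h2Sw : 2 * S ≤ rΦw) (hιw : ∀ r K t s, ∀ V Y, ‖kerOp (kι r K t s V) Y‖ ≤ ‖Y‖)
    (hHw : ∀ r K t s, ∀ V X, ‖kerOp (kH r K t s V) X‖ ≤ B₀w * ‖X‖) (hqw : ∀ r K s, 9 * C2cov (P r K (Sum.inr s)).d * B₀w * (ε₄w + B₀w * bw) < 1)
    (hRCw : ∀ r K s, 6 * (ε₄w + B₀w * bw) ≤ landauRad (P r K (Sum.inr s)).d (P r K (Sum.inr s)).L) (NW : ∀ r K (t : ℝ) s, Λz r K s → Λw r K s → Prop)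
    (hlocW : ∀ r K t s, ∀ V, ∀ A A' : Λw r K s → 𝔄w r K s, ∀ c', (∀ b', NW r K t s c' b' → A b' = A' b') → W𝒱w r K t s V A c' = W𝒱w r K t s V A' c')
    {rW : ℝ} (hreachW : ∀ r K t s, ∀ c' b', NW r K t s c' b' → ϖw r K t s (posz r K t s c') - rW ≤ ϖw r K t s (pos r K t s b')) {rC : ℝ}
    (hreachC : ∀ r K t s, ∀ (c' : ↥(Sw' r K s)) (b' : ↥(Sw r K s)), BondIn (loK (P r K (Sum.inr s)).L (k r K s) c'.1.1) (bondHiK (P r K (Sum.inr s)).L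
      (k r K s) c'.1.1 c'.1.2) b'.1.1 b'.1.2 → ϖw r K t s (posx r K t s c') - rC ≤ ϖw r K t s (pos' r K t s b'))
    (hsupp : ∀ r K t s, ∀ V, ∀ z : Fin (m₀ r K s) → ℂ, ∀ i, 0 < ϖw r K t s (posb r K t s i) → Tw r K t s V z i = 0)
    (hqW : c𝒢 * M𝒢 * (2 * C₄w * a₃w * Real.exp (δw * rW)) < 1)
    (hk : ∀ r K s, 2 * C2cov (P r K (Sum.inr s)).d * landauRad (P r K (Sum.inr s)).d (P r K (Sum.inr s)).L * Real.exp (δw * rC) * (cι * Mι) * (cH *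
      MH) < 1)
    {𝔭 : Bool → ℕ → σ₁ → Type*} (Pw : ∀ r K (t : ℝ) s, Finset (𝔭 r K s))
    (ℓw : ∀ r K (t : ℝ) s, 𝔭 r K s → List ((Λw r K s → 𝔄w r K s) →L[ℂ] Matrix n n ℂ)) (suppw : ∀ r K (t : ℝ) s, 𝔭 r K s → Finset (Λw r K s))
    (ϖPw : ∀ r K (t : ℝ) s, 𝔭 r K s → ℝ)
    (hblindw : ∀ r K t s, ∀ p ∈ Pw r K t s, ∀ ℓ ∈ ℓw r K t s p, ∀ A A' : Λw r K s → 𝔄w r K s, (∀ b' ∈ suppw r K t s p, A b' = A' b') → ℓ A = ℓ A')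
    (hdepthw : ∀ r K t s, ∀ p ∈ Pw r K t s, ∀ b' ∈ suppw r K t s p, ϖPw r K t s p ≤ ϖw r K t s (pos r K t s b'))
    (hϖPw : ∀ r K t s, ∀ p ∈ Pw r K t s, 0 ≤ ϖPw r K t s p) {κwb κcb : Bool → ℕ → ℝ} (hκwb : ∀ r K s, 0 ≤ κwb r (jl r K (Sum.inr s)))
    (hκcb : ∀ r K s, 0 ≤ κcb r (jl r K (Sum.inr s))) (hℓwb : ∀ r K t s, ∀ p ∈ Pw r K t s, ∀ ℓ ∈ ℓw r K t s p, ‖ℓ‖ ≤ κwb r (jl r K (Sum.inr s)))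
    (hcurlw : ∀ r K t s, ∀ p ∈ Pw r K t s, ‖(ℓw r K t s p).sum‖ ≤ κcb r (jl r K (Sum.inr s))) {mw : ℕ}
    (hlenw : ∀ r K t s, ∀ p ∈ Pw r K t s, (ℓw r K t s p).length ≤ mw) (𝓡𝒴w : ∀ r K (t : ℝ) s, AddSubgroup (Λw r K s → 𝔄w r K s))
    (h𝓡𝒴w : ∀ r K t s, IsClosed (𝓡𝒴w r K t s : Set (Λw r K s → 𝔄w r K s))) (𝓡𝒵w : ∀ r K (t : ℝ) s, AddSubgroup (Λz r K s → ℭ r K s))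
    (𝓡ℬw : ∀ r K (t : ℝ) s, AddSubgroup (Λb r K s → 𝔇 r K s)) (h𝒢rw : ∀ r K t s, ∀ V, ∀ f ∈ 𝓡𝒵w r K t s, kerOp (k𝒢 r K t s V) f ∈ 𝓡𝒴w r K t s)
    (hWrw : ∀ r K t s, ∀ V, ∀ Y ∈ 𝓡𝒴w r K t s, W𝒱w r K t s V Y ∈ 𝓡𝒵w r K t s)
    (hιrw : ∀ r K t s, ∀ V, ∀ Y ∈ 𝓡𝒴w r K t s, kerOp (kι r K t s V) Y ∈ skewPi ↥(Sw r K s))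
    (hHrw : ∀ r K t s, ∀ V, ∀ X ∈ skewPi (𝔸 := 𝔸 r K s) ↥(Sw' r K s), kerOp (kH r K t s V) X ∈ 𝓡𝒴w r K t s)
    (hH₁rw : ∀ r K t s, ∀ V, ∀ B ∈ 𝓡ℬw r K t s, kerOp (kH₁ r K t s V) B ∈ 𝓡𝒴w r K t s)
    (hTrw : ∀ r K t s, ∀ V (y : Fin (m₀ r K s) → ℝ), Tw r K t s V (cplx y) ∈ 𝓡ℬw r K t s)
    (hskew : ∀ r K t s, ∀ p ∈ Pw r K t s, ∀ ℓ ∈ ℓw r K t s p, ∀ Y ∈ 𝓡𝒴w r K t s, ℓ Y ∈ skewAdjoint (Matrix n n ℂ))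
    (Bp : ∀ r K (t : ℝ) s, GaugeField (P r K (Sum.inr s)) (jl r K (Sum.inr s)) SU2 → 𝔭 r K s → Matrix n n ℂ) {d : ∀ r K (t : ℝ) s, 𝔭 r K s → ℝ}
    {dbar : Bool → ℕ → ℝ} (hBu : ∀ r K t s, ∀ V, ∀ p ∈ Pw r K t s, Bp r K t s V p ∈ unitary (Matrix n n ℂ))
    (hBd : ∀ r K t s, ∀ V, ∀ p ∈ Pw r K t s, ‖Bp r K t s V p - 1‖ ≤ d r K t s p)
    (hd : ∀ r K t s, ∀ p ∈ Pw r K t s, d r K t s p ≤ dbar r (jl r K (Sum.inr s))) (hdbar : ∀ r K s, 0 ≤ dbar r (jl r K (Sum.inr s)))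
    {Kw : Bool → ℕ → ℝ} (hKw : ∀ r K t s, ∑ p ∈ Pw r K t s, Real.exp (-(δw * ϖPw r K t s p)) ≤ Kw r (jl r K (Sum.inr s))) {Λe : Bool → ℕ → σ₁ → Type*}
    [∀ r K s, Fintype (Λe r K s)] {𝔄 : Bool → ℕ → σ₁ → Type*} [∀ r K s, NormedAddCommGroup (𝔄 r K s)] [∀ r K s, NormedSpace ℂ (𝔄 r K s)]
    [∀ r K s, CompleteSpace (𝔄 r K s)] {δ' : ℝ} {ϖ : ∀ r K (t : ℝ) s, Λe r K s → ℝ} (hδ' : 0 ≤ δ') (hϖ : ∀ r K t s, ∀ b', 0 ≤ ϖ r K t s b')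
    {𝒵e ℬe : Bool → ℕ → σ₁ → Type*} [∀ r K s, NormedAddCommGroup (𝒵e r K s)] [∀ r K s, NormedSpace ℂ (𝒵e r K s)]
    [∀ r K s, NormedAddCommGroup (ℬe r K s)] [∀ r K s, NormedSpace ℂ (ℬe r K s)]
    (𝒢e : ∀ r K t s, GaugeField (P r K (Sum.inr s)) (jl r K (Sum.inr s)) SU2 → (𝒵e r K s →L[ℂ] WSup (pinW δ' (ϖ r K t s)) 1 (𝔄 r K s)))
    (W𝒱e : ∀ r K t s, GaugeField (P r K (Sum.inr s)) (jl r K (Sum.inr s)) SU2 → WSup (pinW δ' (ϖ r K t s)) 1 (𝔄 r K s) → 𝒵e r K s)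
    {B₀e C₄e a₃e be ε₄e : ℝ} (h𝒢e : ∀ r K t s, ∀ V f, ‖𝒢e r K t s V f‖ ≤ B₀e * ‖f‖) (hWe : ∀ r K t s, ∀ V, Prop4Hyp (W𝒱e r K t s V) C₄e a₃e)
    (hB₀e : 0 < B₀e) (hC₄e : 0 ≤ C₄e) (hbe : 0 ≤ be) (hε₄e : 0 ≤ ε₄e) (hdome : 2 * (ε₄e + B₀e * be) ≤ a₃e)
    (hselfe : B₀e * C₄e * (ε₄e + B₀e * be) ^ 2 ≤ ε₄e) (hcontre : 4 * B₀e * C₄e * (ε₄e + B₀e * be) < 1)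
    (H₁e : ∀ r K t s, GaugeField (P r K (Sum.inr s)) (jl r K (Sum.inr s)) SU2 → (ℬe r K s →L[ℂ] WSup (pinW δ' (ϖ r K t s)) 1 (𝔄 r K s)))
    (hH₁e : ∀ r K t s, ∀ V B, ‖H₁e r K t s V B‖ ≤ B₀e * ‖B‖)
    (Te : ∀ r K (t : ℝ) s, GaugeField (P r K (Sum.inr s)) (jl r K (Sum.inr s)) SU2 → ((Fin (m₀ r K s) → ℂ) →L[ℂ] (ℬe r K s))) {rΦe : ℝ}
    (hTbe : ∀ r K t s, ∀ V, ‖Te r K t s V‖ * rΦe < be) (hSre : S < rΦe)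
    (ιe : ∀ r K t s, GaugeField (P r K (Sum.inr s)) (jl r K (Sum.inr s)) SU2 → (WSup (pinW δ' (ϖ r K t s)) 1 (𝔄 r K s) →L[ℂ] WSup (pinW δ' (ϖe₁ r K t
      s)) 1 (𝔸 r K s)))
    (hιe : ∀ r K t s, ∀ V Y, ‖ιe r K t s V Y‖ ≤ ‖Y‖)
    (He : ∀ r K t s, GaugeField (P r K (Sum.inr s)) (jl r K (Sum.inr s)) SU2 → (WSup (pinW δ' (ϖe₂ r K t s)) 1 (𝔸 r K s) →L[ℂ] WSup (pinW δ' (ϖ r K t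
      s)) 1 (𝔄 r K s)))
    (hHe : ∀ r K t s, ∀ V X, ‖He r K t s V X‖ ≤ B₀e * ‖X‖)
    (hqe : ∀ r K s, 9 * (C2cov (P r K (Sum.inr s)).d * Real.exp (2 * δ' * r₀e)) * B₀e * (ε₄e + B₀e * be) < 1)
    (hRCe : ∀ r K s, 3 * (ε₄e + B₀e * be) ≤ landauRad (P r K (Sum.inr s)).d (P r K (Sum.inr s)).L) {𝔱 : Bool → ℕ → σ₁ → Type*}
    (I : ∀ r K (t : ℝ) s, Finset (𝔱 r K s)) {Ef : ∀ r K (t : ℝ) s, 𝔱 r K s → (Λe r K s → 𝔄 r K s) → ℂ} {rE : ℝ} {ee : ∀ r K (t : ℝ) s, 𝔱 r K s → ℝ}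
    (hrE : 0 < rE) (hEd : ∀ r K t s, ∀ i ∈ I r K t s, DifferentiableOn ℂ (Ef r K t s i) (ball 0 rE))
    (hEb : ∀ r K t s, ∀ i ∈ I r K t s, ∀ Z ∈ ball (0 : Λe r K s → 𝔄 r K s) rE, ‖Ef r K t s i Z‖ ≤ ee r K t s i)
    (he0 : ∀ r K t s, ∀ i ∈ I r K t s, 0 ≤ ee r K t s i) (supp : ∀ r K (t : ℝ) s, 𝔱 r K s → Finset (Λe r K s))
    (hblind : ∀ r K t s, ∀ i ∈ I r K t s, ∀ A₁ A₂ : Λe r K s → 𝔄 r K s, (∀ b' ∈ supp r K t s i, A₁ b' = A₂ b') → Ef r K t s i A₁ = Ef r K t s i A₂)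
    (ϖP : ∀ r K (t : ℝ) s, 𝔱 r K s → ℝ) (hdepth : ∀ r K t s, ∀ i ∈ I r K t s, ∀ b' ∈ supp r K t s i, ϖP r K t s i ≤ ϖ r K t s b') {LK : ℝ}
    (hLK : 0 ≤ LK) (hK : ∀ r K t s, ∑ i ∈ I r K t s, 2 * ee r K t s i / rE * Real.exp (-(δ' * ϖP r K t s i)) ≤ LK)
    (hcoupE : ∀ r K s, ((ε₄e + B₀e * be) + B₀e * (4 * (C2cov (P r K (Sum.inr s)).d * Real.exp (2 * δ' * r₀e)) * (ε₄e + B₀e * be) ^ 2)) ≤ rE / 2)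
    {BE₁ : ℝ}
    (hElb₁ : ∀ r K t s, ∀ V (y : Fin (m₀ r K s) → ℝ), ‖y‖ ≤ S → -BE₁ ≤ (∑ i ∈ I r K t s, Ef r K t s i (WSup.toPiL (𝔄 := 𝔄 r K s) (pinW δ' (ϖ r K t s))
      1 (landauExp (fun Y : WSup (pinW δ' (ϖe₁ r K t s)) 1 (𝔸 r K s) => ((toPiL (pinW δ' (ϖe₂ r K t s)) 1).symm (landauCf (P r K (Sum.inr s)).L (Ubg r
      K t s V) (k r K s) (Se r K s) (Se' r K s) (toPiL (pinW δ' (ϖe₁ r K t s)) 1 Y)) : WSup (pinW δ' (ϖe₂ r K t s)) 1 (𝔸 r K s))) (ιe r K t s V) (He r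
      K t s V) (4 * (C2cov (P r K (Sum.inr s)).d * Real.exp (2 * δ' * r₀e)) * (ε₄e + B₀e * be) ^ 2) (solAt (𝒢e r K t s V) 0 (W𝒱e r K t s V) ε₄e (0 :
      𝒵e r K s) (H₁e r K t s V (Te r K t s V (cplx y))) + H₁e r K t s V (Te r K t s V (cplx y)))))).re)
    {Ω : Bool → ℕ → σ₁ → Type*} [∀ r K s, MeasurableSpace (Ω r K s)] (μ : ∀ r K (t : ℝ) s, Measure (Ω r K s)) {g : ∀ r K (t : ℝ) s, Ω r K s → ℝ}
    (hg : ∀ r K t s, ∀ ω, 0 ≤ g r K t s ω)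
    (Aex : ∀ r K (t : ℝ) s, GaugeField (P r K (Sum.inr s)) (jl r K (Sum.inr s)) SU2 → (Fin (m₀ r K s) → ℝ) → Ω r K s → ℝ) {Bd : ℝ} (hBd0 : 0 ≤ Bd)
    (hint : ∀ r K t s, ∀ V, ∀ x ∈ closedBall (0 : Fin (m₀ r K s) → ℝ) S, ∀ c : ℝ, 1 / 2 ≤ c → c ≤ 1 → Integrable (fun ω => g r K t s ω * Real.exp (Aex
      r K t s V (c • x) ω)) (μ r K t s))
    (hpos : ∀ r K t s, ∀ V, ∀ x ∈ closedBall (0 : Fin (m₀ r K s) → ℝ) S, ∀ c : ℝ, 1 / 2 ≤ c → c ≤ 1 → 0 < ∫ ω, g r K t s ω * Real.exp (Aex r K t s V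
      (c • x) ω) ∂(μ r K t s))
    (hA : ∀ r K t s, ∀ V, ∀ x ∈ closedBall (0 : Fin (m₀ r K s) → ℝ) S, ∀ c : ℝ, 1 / 2 ≤ c → c ≤ 1 → ∀ ω, Aex r K t s V x ω ≤ Aex r K t s V (c • x) ω +
      (1 - c) * Bd)
    {BE₂ : ℝ}
    (hElb₂ : ∀ r K t s, ∀ V (y : Fin (m₀ r K s) → ℝ), ‖y‖ ≤ S → -BE₂ ≤ (-Real.log (∫ ω, g r K t s ω * Real.exp (Aex r K t s V y ω) ∂(μ r K t s))))
    (L : ∀ r K (t : ℝ) s, Set (𝒴 r K s →L[ℂ] Matrix n n ℂ)) (𝓡𝒵 : ∀ r K (t : ℝ) s, AddSubgroup (𝒵 r K s))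
    (𝓡ℬ : ∀ r K (t : ℝ) s, AddSubgroup (ℬ r K s)) (h𝒢r : ∀ r K t s, ∀ V, ∀ f ∈ 𝓡𝒵 r K t s, 𝒢 r K t s V f ∈ readOutReal (L r K t s))
    (hWr : ∀ r K t s, ∀ V, ∀ Y ∈ readOutReal (L r K t s), W𝒱 r K t s V Y ∈ 𝓡𝒵 r K t s)
    (hιr : ∀ r K t s, ∀ V, ∀ Y ∈ readOutReal (L r K t s), ιs r K t s V Y ∈ skewPi ↥(Sf r K s))
    (hHr : ∀ r K t s, ∀ V, ∀ X ∈ skewPi (𝔸 := 𝔸 r K s) ↥(Sf' r K s), Hop r K t s V X ∈ readOutReal (L r K t s))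
    (hH₁r : ∀ r K t s, ∀ V, ∀ B ∈ 𝓡ℬ r K t s, H₁ r K t s V B ∈ readOutReal (L r K t s))
    (hTr : ∀ r K t s, ∀ V (y : Fin (m₀ r K s) → ℝ), TΦ r K t s V (cplx y) ∈ 𝓡ℬ r K t s)
    (hRdict : ∀ r K t s, ∀ V, ∀ x ∈ cube (m₀ r K s) S, F r K t (Sum.inr s) (fixTo (combBonds (lo r K s) (hi r K s)) 1 (updateFinset V (Λ r K s)
      (expFibreChart (Λ r K s) 1 (e r K s) x))) = (closedBall (0 : Fin (m₀ r K s) → ℝ) S ∩ ⋂ i ∈ N r K t s, {y | classifier (hPuN r K t s i) (holN r K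
      t s i V) y < θN r K t s i}).indicator (1 : (Fin (m₀ r K s) → ℝ) → ℝ≥0∞) x * ENNReal.ofReal (Real.exp (-((∑ p ∈ Pw r K t s, β r (jl r K (Sum.inr
      s)) * (1 - (Matrix.trace (Bp r K t s V p * holOf (ℓw r K t s p) (fun y => landauExp (landauCfBox (P r K (Sum.inr s)).L (Ubg r K t s V) (k r K s)
      (Sw r K s) (Sw' r K s) (landauRad (P r K (Sum.inr s)).d (P r K (Sum.inr s)).L)) (kerOp (kι r K t s V)) (kerOp (kH r K t s V)) (4 * C2cov (P r K
      (Sum.inr s)).d * (ε₄w + B₀w * bw) ^ 2) (solAt (kerOp (k𝒢 r K t s V)) 0 (W𝒱w r K t s V) ε₄w (0 : Λz r K s → ℭ r K s) (kerOp (kH₁ r K t s V) (Tw r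
      K t s V (cplx y))) + kerOp (kH₁ r K t s V) (Tw r K t s V (cplx y)))) x)).re / Fintype.card n)) + ((∑ i ∈ I r K t s, Ef r K t s i (WSup.toPiL (𝔄
      := 𝔄 r K s) (pinW δ' (ϖ r K t s)) 1 (landauExp (fun Y : WSup (pinW δ' (ϖe₁ r K t s)) 1 (𝔸 r K s) => ((toPiL (pinW δ' (ϖe₂ r K t s)) 1).symm
      (landauCf (P r K (Sum.inr s)).L (Ubg r K t s V) (k r K s) (Se r K s) (Se' r K s) (toPiL (pinW δ' (ϖe₁ r K t s)) 1 Y)) : WSup (pinW δ' (ϖe₂ r K t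
      s)) 1 (𝔸 r K s))) (ιe r K t s V) (He r K t s V) (4 * (C2cov (P r K (Sum.inr s)).d * Real.exp (2 * δ' * r₀e)) * (ε₄e + B₀e * be) ^ 2) (solAt (𝒢e
      r K t s V) 0 (W𝒱e r K t s V) ε₄e (0 : 𝒵e r K s) (H₁e r K t s V (Te r K t s V (cplx x))) + H₁e r K t s V (Te r K t s V (cplx x)))))).re +
      (-Real.log (∫ ω, g r K t s ω * Real.exp (Aex r K t s V x ω) ∂(μ r K t s))))))))
    (hudict : ∀ r K t s, ∀ V, ∀ x ∈ cube (m₀ r K s) S, u r K t (Sum.inr s) (fixTo (combBonds (lo r K s) (hi r K s)) 1 (updateFinset V (Λ r K s)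
      (expFibreChart (Λ r K s) 1 (e r K s) x))) = classifier (hPu r K t s) (fun p => holOf (ℓs r K t s p) (fun y => landauExp ((ball (0 : ↥(Sf r K s)
      → 𝔸 r K s) (landauRad (P r K (Sum.inr s)).d (P r K (Sum.inr s)).L)).indicator (landauCf (P r K (Sum.inr s)).L (1 : B7Prop1Explicit.Site (P r K
      (Sum.inr s)).d → Fin (P r K (Sum.inr s)).d → (𝔸 r K s)ˣ) (k r K s) (Sf r K s) (Sf' r K s))) (ιs r K t s V) (Hop r K t s V) (4 * C2cov (P r K
      (Sum.inr s)).d * (ε₄ + B₀ * (2 * dL * C₁ * ε₁)) ^ 2) (solAt (𝒢 r K t s V) 0 (W𝒱 r K t s V) ε₄ (0 : 𝒵 r K s) (H₁ r K t s V (TΦ r K t s V (cplx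
      y))) + H₁ r K t s V (TΦ r K t s V (cplx y))))) x)
    (hδ0 : 0 ≤ δ) (hδ1 : δ < 1) {c₁ c₂ zs : ℝ}
    (hs₁ : ∀ r K s, κc r (jl r K (Sum.inr s)) * ((ε₄ + B₀ * (2 * dL * C₁ * ε₁)) + B₀ * (4 * C2cov (P r K (Sum.inr s)).d * (ε₄ + B₀ * (2 * dL * C₁ *
      ε₁)) ^ 2)) ≤ c₁ * η r (jl r K (Sum.inr s)) ^ 2 * zs)
    (ha : ∀ r K s, κr r (jl r K (Sum.inr s)) * ((ε₄ + B₀ * (2 * dL * C₁ * ε₁)) + B₀ * (4 * C2cov (P r K (Sum.inr s)).d * (ε₄ + B₀ * (2 * dL * C₁ *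
      ε₁)) ^ 2)) ≤ c₂ * η r (jl r K (Sum.inr s)) * zs)
    (hma : ∀ r K s, m * (κr r (jl r K (Sum.inr s)) * ((ε₄ + B₀ * (2 * dL * C₁ * ε₁)) + B₀ * (4 * C2cov (P r K (Sum.inr s)).d * (ε₄ + B₀ * (2 * dL * C₁
      * ε₁)) ^ 2))) ≤ 1)
    (hsm : ∀ r K s, 36 * (c₁ * zs + m ^ 2 * c₂ ^ 2 * zs ^ 2) / (rΦ / S - 1) ^ 2 ≤ δ * ε r (K - lvl r K (Sum.inr s))) {a : ℝ} (ha0 : 0 ≤ a)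
    (hrad : ∀ r K s, (((P r K (Sum.inr s)).d - 1 : ℕ) : ℝ) * nb r K s * a ≤ 2 * Real.sin (S / 2))
    {Pcore Pcollar : ∀ r K (t : ℝ) s, Set (Plaq (P r K (Sum.inr s)) (jl r K (Sum.inr s)))}
    (hcover : ∀ r K t s, boxPlaqs (lo r K s) (hi r K s) ⊆ Pcore r K t s ∪ (Pcollar r K t s))
    (hcore : ∀ r K t s, ∀ (V : GaugeField (P r K (Sum.inr s)) (jl r K (Sum.inr s)) SU2) (y : ↥(Λ r K s) → SU2), u r K t (Sum.inr s) (fixTo (combBonds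
      (lo r K s) (hi r K s)) 1 (updateFinset V (Λ r K s) y)) < ε r (K - lvl r K (Sum.inr s)) * η r (jl r K (Sum.inr s)) ^ 2 → PlaqSmallOn (Pcore r K t
      s) a (fixTo (combBonds (lo r K s) (hi r K s)) 1 (updateFinset V (Λ r K s) y)))
    (hcollar : ∀ r K t s, ∀ (V : GaugeField (P r K (Sum.inr s)) (jl r K (Sum.inr s)) SU2) (y : ↥(Λ r K s) → SU2), F r K t (Sum.inr s) (fixTo
      (combBonds (lo r K s) (hi r K s)) 1 (updateFinset V (Λ r K s) y)) ≠ 0 → PlaqSmallOn (Pcollar r K t s) a (fixTo (combBonds (lo r K s) (hi r K s))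
      1 (updateFinset V (Λ r K s) y)))
    (hρ : ∀ r j, ρ r j ≤ (1 - δ) / 2) (hβ : ∀ r j, 0 ≤ β r j)
    -- the slot → level majorant on the END-II slots: S104 f4's (= S99 f3b's) constant (written out ONCE), guarded on `S₁ r K`
    (hDslot : ∀ r K t, |t| ≤ l₀ → ∀ s ∈ S₁ r K, 2 * ((m₀ r K s : ℝ) + (3 * (|β r (jl r K (Sum.inr s))| * ((dbar r (jl r K (Sum.inr s)) + 2 * (κcb r
      (jl r K (Sum.inr s)) * (cH₁ * MH₁ * bw / ((1 - c𝒢 * M𝒢 * (2 * C₄w * a₃w * Real.exp (δw * rW))) * (1 - 2 * C2cov (P r K (Sum.inr s)).d *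
      landauRad (P r K (Sum.inr s)).d (P r K (Sum.inr s)).L * Real.exp (δw * rC) * (cι * Mι) * (cH * MH)))) + expTail₂ (mw * (κwb r (jl r K (Sum.inr
      s)) * (cH₁ * MH₁ * bw / ((1 - c𝒢 * M𝒢 * (2 * C₄w * a₃w * Real.exp (δw * rW))) * (1 - 2 * C2cov (P r K (Sum.inr s)).d * landauRad (P r K (Sum.inr
      s)).d (P r K (Sum.inr s)).L * Real.exp (δw * rC) * (cι * Mι) * (cH * MH))))))) / (rΦw / S)) * (2 * (κcb r (jl r K (Sum.inr s)) * (cH₁ * MH₁ * bw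
      / ((1 - c𝒢 * M𝒢 * (2 * C₄w * a₃w * Real.exp (δw * rW))) * (1 - 2 * C2cov (P r K (Sum.inr s)).d * landauRad (P r K (Sum.inr s)).d (P r K (Sum.inr
      s)).L * Real.exp (δw * rC) * (cι * Mι) * (cH * MH)))) + expTail₂ (mw * (κwb r (jl r K (Sum.inr s)) * (cH₁ * MH₁ * bw / ((1 - c𝒢 * M𝒢 * (2 * C₄w
      * a₃w * Real.exp (δw * rW))) * (1 - 2 * C2cov (P r K (Sum.inr s)).d * landauRad (P r K (Sum.inr s)).d (P r K (Sum.inr s)).L * Real.exp (δw * rC)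
      * (cι * Mι) * (cH * MH))))))) / (rΦw / S))) * Kw r (jl r K (Sum.inr s))) + (3 * (LK * (2 * ((ε₄e + B₀e * be) + B₀e * (4 * (C2cov (P r K (Sum.inr
      s)).d * Real.exp (2 * δ' * r₀e)) * (ε₄e + B₀e * be) ^ 2)))) / (rΦe / S - 1) + Bd))) / (1 - δ) ≤ D r (lvl r K (Sum.inr s)))
    -- ══ ON `Sum.inl s` (s : σ₀): THE GIBBS SLOTS — f1b `hac_gibbs_of_identified`'s binders (box data, (SM)₀, `hD₀`, `hF₀`∕`hu₀`) ══
    (lo₀ hi₀ : ∀ r K (s : σ₀), Fin (P r K (Sum.inl s)).d → ℤ) {mb : Bool → ℕ → σ₀ → ℕ}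
    (hN₀ : ∀ r K s κ, hi₀ r K s κ - lo₀ r K s κ < (P r K (Sum.inl s)).sitesPerDir (jl r K (Sum.inl s)))
    (hm : ∀ r K s κ, hi₀ r K s κ ≤ lo₀ r K s κ + mb r K s)
    (Λg : ∀ r K (s : σ₀), Finset (PBond (P r K (Sum.inl s)) (jl r K (Sum.inl s))))
    (hΛbox₀ : ∀ r K s, ∀ b ∈ Λg r K s, b ∈ boxBonds (lo₀ r K s) (hi₀ r K s))
    (hΛcomb₀ : ∀ r K s, Disjoint (Λg r K s) (combBonds (lo₀ r K s) (hi₀ r K s)))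
    (hcov : ∀ r K s, ∀ b ∈ boxBonds (lo₀ r K s) (hi₀ r K s), b ∉ Λg r K s →
      b ∈ (combBonds (lo₀ r K s) (hi₀ r K s) : Finset (PBond (P r K (Sum.inl s)) (jl r K (Sum.inl s)))))
    {m₀g : Bool → ℕ → σ₀ → ℕ} (eg : ∀ r K s, ↥(Λg r K s) × Fin 3 ≃ Fin (m₀g r K s))
    {S0 : ℝ} (hS0 : 0 < S0) (hS08 : S0 ≤ 1 / 8) (hS0π : 3 * S0 ^ 2 < Real.pi ^ 2)
    {σc : Bool → ℕ → σ₀ → ℝ} (hσ : ∀ r K s, 0 < σc r K s)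
    (hrad₀ : ∀ r K s, (((P r K (Sum.inl s)).d - 1 : ℕ) : ℝ) * mb r K s * σc r K s ≤ 2 * S0 / Real.pi)
    {Pug : ∀ r K (s : σ₀), Finset (Plaq (P r K (Sum.inl s)) (jl r K (Sum.inl s)))} (hPug : ∀ r K s, (Pug r K s).Nonempty)
    (hPubox : ∀ r K s, ∀ p ∈ Pug r K s, p ∈ boxPlaqs (lo₀ r K s) (hi₀ r K s))
    (Pwg : ∀ r K (s : σ₀), Finset (Plaq (P r K (Sum.inl s)) (jl r K (Sum.inl s))))
    (hSM : ∀ r K s, 4 * (8 * S0) ^ 2 * Real.exp (2 * (8 * S0)) ≤ δ * (ε r (K - lvl r K (Sum.inl s)) * η r (jl r K (Sum.inl s)) ^ 2))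
    (hSMσ : ∀ r K s, 4 * (8 * S0) ^ 2 * Real.exp (2 * (8 * S0)) ≤ δ * σc r K s)
    (hD₀ : ∀ r K s, 2 * ((m₀g r K s : ℝ) + β r (jl r K (Sum.inl s)) * ∑ _p ∈ Pwg r K s, (8 * S0) * (8 + 4 * (8 * S0))) / (1 - δ) ≤
      D r (lvl r K (Sum.inl s)))
    (hF₀ : ∀ r K t, ∀ s ∈ S₀ r K, F r K t (Sum.inl s) = giF (lo₀ r K s) (hi₀ r K s) (σc r K s) (β r (jl r K (Sum.inl s))) (Pwg r K s))
    (hu₀ : ∀ r K t, ∀ s ∈ S₀ r K, u r K t (Sum.inl s) = wilsonU (hPug r K s))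
    -- ══ END-I's own rows over the DISJOINT SUMS ((R)+[dict], finiteness, `LiveWindow` ×2, `0 < ϑ < 1`, `D ≤ D̄`, rates) ══
    {ι : Type*} {T : ℕ → Finset ι} {A B shA shB : ℕ → ℝ → ι → ℝ}
    {pieceA pieceB : ℕ → ℝ → σ₀ ⊕ σ₁ → ι → ℝ} {MA MB : ℕ → ℝ → σ₀ ⊕ σ₁ → ℝ} {N₁ : ℕ} {νbar Dbar crate ϑ : ℝ}
    (hFfin : ∀ r K t s, ∫⁻ U, F r K t s U ∂(fieldMeasure (P r K s) (jl r K s) SU2) ≠ ∞)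
    (sh_nonnegA : ∀ K t, |t| ≤ l₀ → ∀ τ ∈ T K, 0 ≤ shA K t τ)
    (sh_leA : ∀ K t, |t| ≤ l₀ → ∀ τ ∈ T K, shA K t τ ≤ A K t τ)
    (coverA : ∀ K t, |t| ≤ l₀ → ∀ τ ∈ T K, shA K t τ ≤ ∑ s ∈ (S₀ true K).disjSum (S₁ true K), pieceA K t s τ)
    (hMA : ∀ K t, |t| ≤ l₀ → ∀ s ∈ (S₀ true K).disjSum (S₁ true K), 0 ≤ MA K t s)
    (piece_leA : ∀ K t, |t| ≤ l₀ → ∀ s ∈ (S₀ true K).disjSum (S₁ true K), ∑ τ ∈ T K, pieceA K t s τ ≤ MA K t s *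
      (((fieldMeasure (P true K s) (jl true K s) SU2).withDensity (F true K t s))
        {x | ε true (K - lvl true K s) * (1 - ρ true (lvl true K s)) ≤ u true K t s x / η true (jl true K s) ^ 2 ∧
          u true K t s x / η true (jl true K s) ^ 2 < ε true (K - lvl true K s)}).toReal)
    (total_geA : ∀ K t, |t| ≤ l₀ → ∀ s ∈ (S₀ true K).disjSum (S₁ true K),
      MA K t s * (((fieldMeasure (P true K s) (jl true K s) SU2).withDensity (F true K t s)) Set.univ).toReal ≤
        ∑ τ ∈ T K, A K t τ)
    (sh_nonnegB : ∀ K t, |t| ≤ l₀ → ∀ τ ∈ T K, 0 ≤ shB K t τ)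
    (sh_leB : ∀ K t, |t| ≤ l₀ → ∀ τ ∈ T K, shB K t τ ≤ B K t τ)
    (coverB : ∀ K t, |t| ≤ l₀ → ∀ τ ∈ T K, shB K t τ ≤ ∑ s ∈ (S₀ false K).disjSum (S₁ false K), pieceB K t s τ)
    (hMB : ∀ K t, |t| ≤ l₀ → ∀ s ∈ (S₀ false K).disjSum (S₁ false K), 0 ≤ MB K t s)
    (piece_leB : ∀ K t, |t| ≤ l₀ → ∀ s ∈ (S₀ false K).disjSum (S₁ false K), ∑ τ ∈ T K, pieceB K t s τ ≤ MB K t s *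
      (((fieldMeasure (P false K s) (jl false K s) SU2).withDensity (F false K t s))
        {x | ε false (K - lvl false K s) * (1 - ρ false (lvl false K s)) ≤ u false K t s x / η false (jl false K s) ^ 2 ∧
          u false K t s x / η false (jl false K s) ^ 2 < ε false (K - lvl false K s)}).toReal)
    (total_geB : ∀ K t, |t| ≤ l₀ → ∀ s ∈ (S₀ false K).disjSum (S₁ false K),
      MB K t s * (((fieldMeasure (P false K s) (jl false K s) SU2).withDensity (F false K t s)) Set.univ).toReal ≤
        ∑ τ ∈ T K, B K t τ)
    (hw : ∀ r, LiveWindow (fun K => (S₀ r K).disjSum (S₁ r K)) (lvl r) N₁ νbar) (hϑ0 : 0 < ϑ) (hϑ1 : ϑ < 1)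
    (hDbar : ∀ r j, D r j ≤ Dbar) (hrate : ∀ r j, ρ r j ≤ crate * ϑ ^ j) :
    ShellWeightBound l₀ T A B shA shB
      (fun K => ∑ s ∈ (S₀ true K).disjSum (S₁ true K), D true (lvl true K s) * ρ true (lvl true K s) +
        ∑ s ∈ (S₀ false K).disjSum (S₁ false K), D false (lvl false K s) * ρ false (lvl false K s)) := by
  -- the background-mediated slots: file 1⁵ (S104 f4 ∘ S90) at `s ↦ Sum.inr s`
  have hlive := hac_live_of_assembled_decay_levels_cfB7_lin_coTests (fun r K s => P r K (Sum.inr s)) (fun r K s => jl r K (Sum.inr s)) (fun r K s => lvl r K (Sum.inr s)) hη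
    hε hρ0 hn hN Λ hΛbox hΛcomb e hS hSπ hF hFi hu hui hPu N hPuN holN hRN hθN hδ0N hδ1N hSMN hANN 𝒢 W𝒱 h𝒢 hW hB₀ hC₄ hε₄ hdL hC₁ hε₁ hB₃ h1 h2 h3 H₁
    hH₁ TΦ hTb hSr k Sf Sf' Sw Sw' Se Se' Ubg hUbg hα hα3 hα4 hα6 h52locw h52loce ϖe₁ ϖe₂ hϖe₁ hϖe₂ hreache ιs hι Hop hH h18 hcoup h3R ℓs hκ hℓ hlen
    hκc hcurl hδw ϖw dis hϖw pos posz pos' posx posb k𝒢 kι kH kH₁ hc𝒢 hM𝒢 hk𝒢 hM𝒢' hcι hMι hkι hMι' hcH hMH hkH hMH' hcH₁ hMH₁ hkH₁ hMH₁' W𝒱w h𝒢w hWw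
    hB₀w hC₄w hε₄w hdomw hselfw hcontrw hH₁w Tw hTbw h2Sw hιw hHw hqw hRCw NW hlocW hreachW hreachC hsupp hqW hk Pw ℓw suppw ϖPw hblindw hdepthw hϖPw
    hκwb hκcb hℓwb hcurlw hlenw 𝓡𝒴w h𝓡𝒴w 𝓡𝒵w 𝓡ℬw h𝒢rw hWrw hιrw hHrw hH₁rw hTrw hskew Bp hBu hBd hd hdbar hKw hδ' hϖ 𝒢e W𝒱e h𝒢e hWe hB₀e hC₄e hbe hε₄e
    hdome hselfe hcontre H₁e hH₁e Te hTbe hSre ιe hιe He hHe hqe hRCe I hrE hEd hEb he0 supp hblind ϖP hdepth hLK hK hcoupE hElb₁ μ hg Aex hBd0 hint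
    hpos hA hElb₂ L 𝓡𝒵 𝓡ℬ h𝒢r hWr hιr hHr hH₁r hTr hRdict hudict hδ0 hδ1 hs₁ ha hma hsm ha0 hrad hcover hcore hcollar hρ hβ
  -- the Gibbs slots: leaf-06-g7's f1b at `s ↦ Sum.inl s`
  have hgibbs := hac_gibbs_of_identified (fun r K s => P r K (Sum.inl s)) (fun r K s => jl r K (Sum.inl s))
    (fun r K s => lvl r K (Sum.inl s)) hη hε hρ0 lo₀ hi₀ hN₀ hm Λg hΛbox₀ hΛcomb₀ hcov eg hS0 hS08 hS0π hσ hrad₀ hPug hPubox Pwg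
    hδ0 hδ1 hρ hβ hSM hSMσ hD₀ S₀ (fun r K t s => F r K t (Sum.inl s)) (fun r K t s => u r K t (Sum.inl s)) hF₀ hu₀
  -- both kinds, at the level constant `D r (lvl r K s)`
  have hunion : ∀ (r : Bool) (K : ℕ) (t : ℝ), |t| ≤ l₀ → ∀ s ∈ (S₀ r K).disjSum (S₁ r K),
      SlotAntiConcentration ((fieldMeasure (P r K s) (jl r K s) SU2).withDensity (F r K t s))
        (fun U => u r K t s U / η r (jl r K s) ^ 2) (ε r (K - lvl r K s)) (ρ r (lvl r K s)) (D r (lvl r K s)) := by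
    intro r K t ht s hs
    rcases Finset.mem_disjSum.1 hs with ⟨a, ha, rfl⟩ | ⟨b, hb, rfl⟩
    · exact hgibbs r K t a ha
    · exact slotAntiConcentration_mono (hρ0 r _) (hDslot r K t ht b hb) (hlive r K t b)
  -- END-I (S27 §2: slot towers, age thresholds) with `DslotX := DX ∘ lvlX` and `hacA`∕`hacB` := `hunion true`∕`hunion false`
  exact shellWeightBound_of_towerData_sync (G := SU2) (PA := P true) (jA := jl true) (PB := P false) (jB := jl false)
    (SA := fun K => (S₀ true K).disjSum (S₁ true K)) (SB := fun K => (S₀ false K).disjSum (S₁ false K))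
    (θA := fun K s => ε true (K - lvl true K s)) (θB := fun K s => ε false (K - lvl false K s))
    (uA := fun K t s U => u true K t s U / η true (jl true K s) ^ 2)
    (uB := fun K t s U => u false K t s U / η false (jl false K s) ^ 2)
    (DslotA := fun K _ s => D true (lvl true K s)) (DslotB := fun K _ s => D false (lvl false K s))
    (hFfin true) sh_nonnegA sh_leA coverA hMA piece_leA total_geA (hD0 true) (hρ0 true) (fun K t _ s _ => le_rfl)
    (hunion true)
    (hFfin false) sh_nonnegB sh_leB coverB hMB piece_leB total_geB (hD0 false) (hρ0 false) (fun K t _ s _ => le_rfl)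
    (hunion false)
    (hw true) (hw false) hϑ0 hϑ1 (hDbar true) (hDbar false) (hrate true) (hrate false)

end Summit.QuantumFields.BalabanUV.T4Continuum.ShellMeasureLiveEndOneCallUnionLevelsCfLinCoTests

end
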